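import Summits.RiemannHypothesis.RiemannHypothesis.Theses.SignCone
import Summits.RiemannHypothesis.RiemannHypothesis.Theorems.SignConeSignConeOscillatoryTwoBump
import Literature.NumberTheory.LFunctions.WeilExplicitArchTermProofs
import Literature.NumberTheory.LFunctions.WeilArchimedeanMoments

/-!
# `SignConeOscillatory` (crux stmt-RiemannHypothesis-16302) — negative lemma: positive-definiteness is load-bearing

Crux-disprover record (seat `refuter-cdisprove-stmt-RiemannHypothesis-16302-0`), companion of the crux workfile
`Cruxes/SignConeOscillatory/Disproof.lean`. No definitions: the mutated statement is spelled out inline.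

The crux `Summit.RiemannHypothesis.RiemannHypothesis.Theses.SignCone.SignConeOscillatory` asserts the unit-slack
sign-cone inequality `-Re F(0) ≤ Re W_ar(F)` (`W_ar = weilPolarTerm + weilArchTerm`, written over Mathlib
primitives in the item) for every AUTOCORRELATION SUM `F = Σᵢ gᵢ ⋆ g̃ᵢ` of Weil tests supported in `[-a, a]` that is
non-negative at the nodes `log n` (`n ≥ 2`) and negative somewhere on `|t| ≥ log 2`. It is RH-implied
(`SignCone.signConeOscillatory_of_riemannHypothesis`, landed), so no refutation exists short of `¬RH`; this file
shows instead that the CONE STRUCTURE of `F` cannot be weakened to its cheap consequences: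

* `signConeOscillatory_false_without_PD` — replace "`F = Σᵢ gᵢ ⋆ g̃ᵢ`, `supp gᵢ ⊆ [-a, a]`" by "`F` smooth,
  compactly supported in `[-2a, 2a]` and HERMITIAN (`F(-u) = conj F(u)`)", keeping the node hypothesis, the
  oscillation hypothesis and the conclusion VERBATIM: the statement is FALSE.
  Witness (`a = 1`): `F = -(φ(· - 9/10) + φ(· + 9/10))`, `φ = WeilContinuous.moll 11` the normalised smooth bump of
  radius `1/12`: `F` vanishes at every node (`|log n - 9/10| ≥ 1/12` for all `n ≥ 2`) and at `0`, `Re F(9/10) < 0`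
  with `9/10 ≥ log 2`, while in Bombieri's form of the archimedean term
  (`weilArchTermBombieri_eq_weilArchTerm_holds`) `Re W_ar(F) = ∫ F·2cosh(t/2) + ∫₀^∞ e^{t/2} φ(t - 9/10)/sinh t dt
  ≤ -4 + e·(60/49) < 0 = -Re F(0)`.

Reading for provers: hermitian symmetry, smoothness, support, node signs and far-field negativity together do not
control the polar term; any proof must use positive-definiteness of `F` (at least `Re F(0) ≥ |F(t)|`-type
domination of the origin, and in fact more: see `Disproof.lean`, §A′).
-/

noncomputable section

-- `Summit.RiemannHypothesis.RiemannHypothesis.…` repeats a namespace component by design (D-0017 layout).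
set_option linter.dupNamespace false

open scoped BigOperators ComplexConjugate Topology
open Complex MeasureTheory Set Filter

namespace Summit.RiemannHypothesis.RiemannHypothesis.Theorems.SignConeOscillatory.Negative

open Literature.NumberTheory.LFunctions
open Summit.RiemannHypothesis.RiemannHypothesis.Theorems.SignCone

/-! ## The bump `φ = moll 11` (radius `1/12`) -/

/-- `rOut (bump 11) = 1/12`. [folklore] -/
theorem bump11_rOut : (WeilContinuous.bump 11).rOut = 1 / 12 := by
  rw [WeilContinuous.bump_rOut]; norm_num

/-- `φ(x) = 0` for `|x| ≥ 1/12`. [folklore] -/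
theorem moll11_eq_zero {x : ℝ} (hx : 1 / 12 ≤ |x|) : WeilContinuous.moll 11 x = 0 :=
  WeilContinuous.moll_eq_zero (by rwa [bump11_rOut])

/-- `φ` is even. [folklore] -/
theorem moll_neg (N : ℕ) (x : ℝ) : WeilContinuous.moll N (-x) = WeilContinuous.moll N x := by
  simp [WeilContinuous.moll, (WeilContinuous.bump N).normed_neg]

/-- `Re φ(0) > 0`. [folklore] -/
theorem re_moll_zero_pos (N : ℕ) : 0 < (WeilContinuous.moll N 0).re := by
  simp only [WeilContinuous.moll, Complex.ofReal_re]
  have h0 : (WeilContinuous.bump N).normed volume 0 ≠ 0 := by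
    have : (0 : ℝ) ∈ Function.support ((WeilContinuous.bump N).normed volume) := by
      rw [(WeilContinuous.bump N).support_normed_eq]
      exact Metric.mem_ball_self (WeilContinuous.bump N).rOut_pos
    exact this
  exact lt_of_le_of_ne ((WeilContinuous.bump N).nonneg_normed 0) (Ne.symm h0)

/-! ## The witness `F = -(φ(· - 9/10) + φ(· + 9/10))` -/

/-- The witness is a Weil test function. [folklore] -/
theorem isWeilTest_negTwoBump (N : ℕ) (c : ℝ) :
    IsWeilTest (fun u => -(WeilContinuous.moll N (u - c) + WeilContinuous.moll N (u + c))) := by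
  have h1 : IsWeilTest (fun u => WeilContinuous.moll N (u + c)) :=
    isWeilTest_translate (WeilContinuous.isWeilTest_moll N) c
  have h2 : IsWeilTest (fun u => WeilContinuous.moll N (u - c)) := by
    have := isWeilTest_translate (WeilContinuous.isWeilTest_moll N) (-c)
    simpa only [← sub_eq_add_neg] using this
  exact ⟨(h2.1.add h1.1).neg, (h2.2.add h1.2).neg⟩

/-- The witness vanishes for `|u| ≥ 1`. [folklore] -/
theorem negTwoBump_eq_zero {u : ℝ} (hu : 1 ≤ |u|) :
    -(WeilContinuous.moll 11 (u - 9 / 10) + WeilContinuous.moll 11 (u + 9 / 10)) = 0 := by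
  have h1 : 1 / 12 ≤ |u - 9 / 10| := by
    rcases le_or_gt 0 u with hu0 | hu0
    · rw [abs_of_nonneg hu0] at hu; rw [abs_of_nonneg (by linarith)]; linarith
    · rw [abs_of_neg hu0] at hu; rw [abs_of_neg (by linarith)]; linarith
  have h2 : 1 / 12 ≤ |u + 9 / 10| := by
    rcases le_or_gt 0 u with hu0 | hu0
    · rw [abs_of_nonneg hu0] at hu; rw [abs_of_nonneg (by linarith)]; linarith
    · rw [abs_of_neg hu0] at hu; rw [abs_of_neg (by linarith)]; linarith
  rw [moll11_eq_zero h1, moll11_eq_zero h2, add_zero, neg_zero]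

/-- `log 2 ≤ 7/10` and `1 ≤ log 3`. [folklore] -/
theorem log_two_le_and_one_le_log_three : Real.log 2 ≤ 7 / 10 ∧ (1 : ℝ) ≤ Real.log 3 := by
  refine ⟨by linarith [Real.log_two_lt_d9], ?_⟩
  rw [Real.le_log_iff_exp_le (by norm_num : (0 : ℝ) < 3)]
  linarith [Real.exp_one_lt_d9]

/-- The witness vanishes at every node `log n`, `n ≥ 2`. [folklore] -/
theorem negTwoBump_log_nat_eq_zero {n : ℕ} (hn : 2 ≤ n) :
    -(WeilContinuous.moll 11 (Real.log n - 9 / 10) + WeilContinuous.moll 11 (Real.log n + 9 / 10)) = 0 := by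
  obtain ⟨hl2, hl3⟩ := log_two_le_and_one_le_log_three
  have hn' : (2 : ℝ) ≤ n := by exact_mod_cast hn
  have hlog2n : Real.log 2 ≤ Real.log n := Real.log_le_log (by norm_num) hn'
  have hlog2 : 0 < Real.log 2 := Real.log_pos (by norm_num)
  have h2 : 1 / 12 ≤ |Real.log n + 9 / 10| := by
    rw [abs_of_nonneg (by linarith)]; linarith
  have h1 : 1 / 12 ≤ |Real.log n - 9 / 10| := by
    rcases Nat.lt_or_ge n 3 with h3 | h3
    · have : n = 2 := by omega
      subst this
      rw [show ((2 : ℕ) : ℝ) = 2 by norm_num, abs_of_nonpos (by linarith)]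
      linarith
    · have h3' : (3 : ℝ) ≤ n := by exact_mod_cast h3
      have hlog3n : Real.log 3 ≤ Real.log n := Real.log_le_log (by norm_num) h3'
      rw [abs_of_nonneg (by linarith)]
      linarith
  rw [moll11_eq_zero h1, moll11_eq_zero h2, add_zero, neg_zero]

/-! ## The main theorem -/

/-- **Positive-definiteness is load-bearing for `SignConeOscillatory`.** The crux with its cone structure
"`F = Σᵢ gᵢ ⋆ g̃ᵢ`, `gᵢ` Weil tests supported in `[-a, a]`" replaced by "`F` a smooth, compactly supported
(in `[-2a, 2a]`), hermitian function" — node hypothesis, oscillation hypothesis and conclusion verbatim — is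
false: witness `a = 1`, `F = -(φ(· - 9/10) + φ(· + 9/10))`, `φ = WeilContinuous.moll 11`. [folklore] -/
theorem signConeOscillatory_false_without_PD :
    ¬ (∀ a : ℝ, 0 < a → ∀ F : ℝ → ℂ,
        (ContDiff ℝ ((⊤ : ℕ∞) : WithTop ℕ∞) F ∧ HasCompactSupport F) ∧ tsupport F ⊆ Set.Icc (-(2 * a)) (2 * a) →
        (∀ u : ℝ, F (-u) = (starRingEnd ℂ) (F u)) →
        (∀ n : ℕ, 2 ≤ n → 0 ≤ (F (Real.log n)).re) → (∃ t : ℝ, Real.log 2 ≤ |t| ∧ (F t).re < 0) →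
        let M : ℂ → ℂ := fun s => ∫ u : ℝ, F u * Complex.exp ((s - 1 / 2) * u);
        -(F 0).re ≤ (M 0 + M 1 + ((1 / (2 * Real.pi) : ℂ) * (∫ t : ℝ, M (1 / 2 + t * Complex.I) *
          ((Complex.digamma (1 / 4 + t / 2 * Complex.I)).re : ℂ)) - F 0 * (Real.log Real.pi : ℂ))).re) := by
  intro h
  set F : ℝ → ℂ := fun u => -(WeilContinuous.moll 11 (u - 9 / 10) + WeilContinuous.moll 11 (u + 9 / 10))
    with hFdef
  set br : ℝ → ℝ := (WeilContinuous.bump 11).normed volume with hbr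
  have hmoll : ∀ x : ℝ, WeilContinuous.moll 11 x = ((br x : ℝ) : ℂ) := fun x => rfl
  have hF : IsWeilTest F := isWeilTest_negTwoBump 11 (9 / 10)
  obtain ⟨hl2, hl3⟩ := log_two_le_and_one_le_log_three
  -- the hypotheses of the mutated statement at `a = 1`
  have hsupp : tsupport F ⊆ Set.Icc (-(2 * (1 : ℝ))) (2 * 1) := by
    refine closure_minimal (fun u hu => ?_) isClosed_Icc
    rw [Function.mem_support] at hu
    by_contra hu'
    refine hu (negTwoBump_eq_zero ?_)
    rw [mem_Icc, not_and_or, not_le, not_le] at hu'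
    rcases hu' with h' | h'
    · calc (1 : ℝ) ≤ -u := by linarith
        _ ≤ |u| := neg_le_abs u
    · calc (1 : ℝ) ≤ u := by linarith
        _ ≤ |u| := le_abs_self u
  have heven : ∀ u : ℝ, F (-u) = F u := by
    intro u
    simp only [hFdef]
    rw [show -u - 9 / 10 = -(u + 9 / 10) by ring, show -u + 9 / 10 = -(u - 9 / 10) by ring,
      moll_neg, moll_neg, add_comm]
  have hreal : ∀ u : ℝ, (starRingEnd ℂ) (F u) = F u := by
    intro u
    simp only [hFdef, map_neg, map_add, conj_moll]
  have hherm : ∀ u : ℝ, F (-u) = (starRingEnd ℂ) (F u) := fun u => by rw [heven, hreal]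
  have hnodes : ∀ n : ℕ, 2 ≤ n → 0 ≤ (F (Real.log n)).re := by
    intro n hn
    simp only [hFdef, negTwoBump_log_nat_eq_zero hn, Complex.zero_re, le_refl]
  have hosc : ∃ t : ℝ, Real.log 2 ≤ |t| ∧ (F t).re < 0 := by
    refine ⟨9 / 10, by rw [abs_of_pos (by norm_num)]; linarith, ?_⟩
    have h18 : WeilContinuous.moll 11 (9 / 10 + 9 / 10) = 0 :=
      moll11_eq_zero (by rw [abs_of_pos (by norm_num)]; norm_num)
    simp only [hFdef, sub_self, h18, add_zero, Complex.neg_re, neg_lt_zero]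
    exact re_moll_zero_pos 11
  have hc0 : WeilContinuous.moll 11 (0 + 9 / 10) = 0 :=
    moll11_eq_zero (by rw [zero_add, abs_of_pos (by norm_num)]; norm_num)
  have hF0 : F 0 = 0 := by
    have h1 : WeilContinuous.moll 11 (0 - 9 / 10) = 0 := by
      rw [show (0 : ℝ) - 9 / 10 = -(0 + 9 / 10) by ring, moll_neg]; exact hc0
    simp only [hFdef, h1, hc0, add_zero, neg_zero]
  -- the mutated statement at the witness, in the Literature vocabulary (definitional unfolding)
  have key : -(F 0).re ≤ (weilPolarTerm F + weilArchTerm F).re :=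
    h 1 one_pos F ⟨hF, hsupp⟩ hherm hnodes hosc
  rw [hF0, Complex.zero_re, neg_zero] at key
  -- it remains to show `Re W_ar(F) < 0`
  suffices hneg : (weilPolarTerm F + weilArchTerm F).re < 0 by linarith
  have hbr_nn : ∀ x, 0 ≤ br x := fun x => (WeilContinuous.bump 11).nonneg_normed x
  have hbr_cont : Continuous br := (WeilContinuous.bump 11).continuous_normed
  have hbr_int1 : ∫ x, br x = 1 := (WeilContinuous.bump 11).integral_normed
  have hbr_zero : ∀ {x : ℝ}, 1 / 12 ≤ |x| → br x = 0 := fun {x} hx => by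
    have := moll11_eq_zero hx
    rwa [hmoll, Complex.ofReal_eq_zero] at this
  /- (1) the polar term: `Re (F̂(0) + F̂(1)) = ∫ F (e^{-t/2} + e^{t/2}) ≤ ∫ 2F = -4` -/
  have hpolar : (weilPolarTerm F).re ≤ -4 := by
    have hI := fun s : ℂ => integrable_weilIntegrand hF.1.continuous hF.2 s
    have e1 : weilPolarTerm F = ∫ t : ℝ, F t * (cexp ((0 - 1 / 2) * t) + cexp ((1 - 1 / 2) * t)) := by
      unfold weilPolarTerm weilMellin
      rw [← integral_add (hI 0) (hI 1)]
      congr 1 with t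
      ring
    have hpt : ∀ t : ℝ, F t * (cexp ((0 - 1 / 2) * t) + cexp ((1 - 1 / 2) * t)) =
        (((-(br (t - 9 / 10) + br (t + 9 / 10))) * (Real.exp (-(t / 2)) + Real.exp (t / 2)) : ℝ) : ℂ) := by
      intro t
      have ea : cexp ((0 - 1 / 2) * (t : ℂ)) = ((Real.exp (-(t / 2)) : ℝ) : ℂ) := by
        rw [Complex.ofReal_exp]; congr 1; push_cast; ring
      have eb : cexp ((1 - 1 / 2) * (t : ℂ)) = ((Real.exp (t / 2) : ℝ) : ℂ) := by
        rw [Complex.ofReal_exp]; congr 1; push_cast; ring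
      rw [ea, eb]
      simp only [hFdef, hmoll]
      push_cast
      ring
    have e2 : (weilPolarTerm F).re =
        ∫ t : ℝ, (-(br (t - 9 / 10) + br (t + 9 / 10))) * (Real.exp (-(t / 2)) + Real.exp (t / 2)) := by
      rw [e1]
      simp_rw [hpt]
      rw [integral_complex_ofReal, Complex.ofReal_re]
    rw [e2]
    have hle : ∀ t : ℝ, (-(br (t - 9 / 10) + br (t + 9 / 10))) * (Real.exp (-(t / 2)) + Real.exp (t / 2)) ≤
        -2 * (br (t - 9 / 10) + br (t + 9 / 10)) := by
      intro t
      have hsum : 0 ≤ br (t - 9 / 10) + br (t + 9 / 10) := add_nonneg (hbr_nn _) (hbr_nn _)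
      have hcosh : 2 ≤ Real.exp (-(t / 2)) + Real.exp (t / 2) := by
        have h1 := Real.one_le_cosh (t / 2)
        rw [Real.cosh_eq] at h1
        linarith
      nlinarith
    have hint_br : ∀ c : ℝ, Integrable fun t : ℝ => br (t + c) := fun c =>
      (WeilContinuous.bump 11).integrable_normed.comp_add_right c
    have hint_rhs : Integrable fun t : ℝ => -2 * (br (t - 9 / 10) + br (t + 9 / 10)) := by
      have := ((hint_br (-(9 / 10))).add (hint_br (9 / 10))).const_mul (-2)
      refine this.congr (Eventually.of_forall fun t => ?_)
      simp only [Pi.add_apply, sub_eq_add_neg]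
    have hint_lhs : Integrable fun t : ℝ =>
        (-(br (t - 9 / 10) + br (t + 9 / 10))) * (Real.exp (-(t / 2)) + Real.exp (t / 2)) := by
      refine Continuous.integrable_of_hasCompactSupport (by fun_prop) ?_
      refine HasCompactSupport.mul_right ?_
      refine HasCompactSupport.neg ?_
      exact ((WeilContinuous.bump 11).hasCompactSupport_normed.comp_homeomorph
          (Homeomorph.addRight (-(9 / 10 : ℝ)))).add
        ((WeilContinuous.bump 11).hasCompactSupport_normed.comp_homeomorph (Homeomorph.addRight (9 / 10 : ℝ)))
    calc ∫ t : ℝ, (-(br (t - 9 / 10) + br (t + 9 / 10))) * (Real.exp (-(t / 2)) + Real.exp (t / 2))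
        ≤ ∫ t : ℝ, -2 * (br (t - 9 / 10) + br (t + 9 / 10)) := integral_mono hint_lhs hint_rhs hle
      _ = -4 := by
          rw [integral_const_mul, integral_add ?_ (hint_br _), integral_add_right_eq_self (μ := volume) br,
            hbr_int1]
          · have := integral_sub_right_eq_self (μ := (volume : Measure ℝ)) br (9 / 10)
            rw [this, hbr_int1]; norm_num
          · have := hint_br (-(9 / 10))
            simpa only [sub_eq_add_neg] using this
  /- (2) the archimedean term in Bombieri's form: `Re W_∞(F) = ∫₀^∞ e^{t/2} φ(t - 9/10)/sinh t ≤ e·60/49` -/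
  have harch : (weilArchTerm F).re ≤ Real.exp 1 * (60 / 49) := by
    rw [← weilArchTermBombieri_eq_weilArchTerm_holds hF, weilArchTermBombieri_eq, hF0]
    have hint_eq : ∀ t ∈ Ioi (0 : ℝ),
        ((Real.exp (t / 2) : ℂ) * (F t + F (-t)) - 2 * (0 : ℂ)) / (2 * Real.sinh t : ℂ) =
          ((-(Real.exp (t / 2) * br (t - 9 / 10) / Real.sinh t) : ℝ) : ℂ) := by
      intro t ht
      have ht0 : 0 < t := ht
      have hp : br (t + 9 / 10) = 0 := hbr_zero (by rw [abs_of_pos (by linarith)]; linarith)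
      have hs : (Real.sinh t : ℂ) ≠ 0 := by exact_mod_cast (Real.sinh_pos_iff.2 ht0).ne'
      rw [heven t]
      simp only [hFdef, hmoll, hp]
      push_cast
      field_simp
      ring
    rw [setIntegral_congr_fun measurableSet_Ioi hint_eq, integral_complex_ofReal]
    simp only [mul_zero, zero_sub, Complex.neg_re, Complex.ofReal_re, integral_neg, neg_neg]
    -- pointwise bound of the (everywhere non-negative) integrand
    set K : ℝ := Real.exp 1 * (60 / 49) with hK
    have hKpos : 0 < K := by positivity
    have hpw : ∀ t : ℝ, Real.exp (t / 2) * br (t - 9 / 10) / Real.sinh t ≤ K * br (t - 9 / 10) := by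
      intro t
      by_cases hb : br (t - 9 / 10) = 0
      · simp [hb]
      · have ht : |t - 9 / 10| < 1 / 12 := by
          by_contra hh; exact hb (hbr_zero (not_lt.1 hh))
        rw [abs_lt] at ht
        have ht0 : 49 / 60 ≤ t := by linarith [ht.1]
        have hsinh : 49 / 60 ≤ Real.sinh t := ht0.trans (Real.self_le_sinh_iff.2 (by linarith))
        have hsinh_pos : 0 < Real.sinh t := by linarith
        have hexp : Real.exp (t / 2) ≤ Real.exp 1 := Real.exp_le_exp.2 (by linarith [ht.2])
        rw [div_le_iff₀ hsinh_pos]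
        have hb0 : 0 < br (t - 9 / 10) := lt_of_le_of_ne (hbr_nn _) (Ne.symm hb)
        calc Real.exp (t / 2) * br (t - 9 / 10) ≤ Real.exp 1 * br (t - 9 / 10) :=
              mul_le_mul_of_nonneg_right hexp (hbr_nn _)
          _ = K * br (t - 9 / 10) * (49 / 60) := by rw [hK]; ring
          _ ≤ K * br (t - 9 / 10) * Real.sinh t :=
              mul_le_mul_of_nonneg_left hsinh (by positivity)
    have hnn : ∀ t : ℝ, 0 ≤ Real.exp (t / 2) * br (t - 9 / 10) / Real.sinh t := by
      intro t
      by_cases hb : br (t - 9 / 10) = 0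
      · simp [hb]
      · have ht : |t - 9 / 10| < 1 / 12 := by
          by_contra hh; exact hb (hbr_zero (not_lt.1 hh))
        rw [abs_lt] at ht
        have hsinh : 0 < Real.sinh t := Real.sinh_pos_iff.2 (by linarith [ht.1])
        exact div_nonneg (mul_nonneg (Real.exp_pos _).le (hbr_nn _)) hsinh.le
    have hint_br : Integrable fun t : ℝ => br (t - 9 / 10) := by
      have : Integrable fun t : ℝ => br (t + -(9 / 10)) :=
        (WeilContinuous.bump 11).integrable_normed.comp_add_right (-(9 / 10))
      simpa only [sub_eq_add_neg] using this
    calc ∫ t in Ioi (0 : ℝ), Real.exp (t / 2) * br (t - 9 / 10) / Real.sinh t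
        ≤ ∫ t in Ioi (0 : ℝ), K * br (t - 9 / 10) :=
          integral_mono_of_nonneg (Eventually.of_forall hnn) (hint_br.const_mul K).integrableOn
            (Eventually.of_forall hpw)
      _ ≤ ∫ t : ℝ, K * br (t - 9 / 10) :=
          setIntegral_le_integral (hint_br.const_mul K)
            (Eventually.of_forall fun t => mul_nonneg hKpos.le (hbr_nn _))
      _ = K := by
          rw [integral_const_mul, integral_sub_right_eq_self (μ := (volume : Measure ℝ)) br, hbr_int1, mul_one]
  /- (3) conclusion: `Re W_ar(F) ≤ -4 + e·60/49 < 0` -/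
  have he : Real.exp 1 * (60 / 49) < 4 := by
    have := Real.exp_one_lt_d9
    nlinarith
  rw [Complex.add_re]
  linarith

end Summit.RiemannHypothesis.RiemannHypothesis.Theorems.SignConeOscillatory.Negative

end
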